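import Summits.AtomisticToContinuum.BoseEinsteinCondensation.Theorems.BECCutLineWeakDisorderGroundStateRigidityStubTruncDiagonal
import Summits.AtomisticToContinuum.BoseEinsteinCondensation.Theorems.BECCutLineWeakDisorderGroundStateRigidityStubVanishOffFree
import Summits.AtomisticToContinuum.BoseEinsteinCondensation.Theorems.BECCutLineWeakDisorderGroundStateRigidityStubEnergyTruncAux
import Literature.Analysis.FunctionSpaces.TestFunctionDensity
import HarnessLib

/-!
# BECHardSphereReduction / HardCoreDominates — the cut to the hard core, from Rellich compactness
# and the hard-sphere closed energy (stub `stub_cutToHardCore_of`, 2b-G, of line `birth`)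

Crux `HardCoreDominates` (stmt-AtomisticToContinuum-11884) of route `BECHardSphereReduction`, line
`birth` (lead c1). Along the coupling path `v_t := v + t·1_{(-∞,R]}` (`t : ℝ≥0`) towards the hard
spheres `HS_R := ⊤·1_{(-∞,R]}` at fixed `(N, L)`, this file proves the registered stub
`stub_cutToHardCore_of`, the pure compactness / bookkeeping implication `HR → HD → C`:

* `HR` (Rellich in the box, the neighbouring stub `stub_dirichletRellich`): Dirichlet trial states
  with bounded kinetic energy have an `L²`-convergent subsequence with a measurable limit;
* `HD` (maximal form = minimal form for hard spheres, the neighbouring stub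
  `stub_hardSphereClosedEnergy`): a measurable function vanishing a.e. on the core set
  `K_R = {∃ i ≠ j, |xᵢ - xⱼ| ≤ R}` has `closedEnergy HS_R ≤ closedEnergy 0`;
* `C`: for every `δ, ε > 0` there is `T` such that for `t ≥ T` some slack `δ' > 0` works: every
  `δ'`-near-minimiser `Ψ` of `v_t` is `ε`-close in `L²` to a `δ`-near-minimiser of `HS_R`.

Both hypotheses are taken as such (they are landed separately); nothing here is physics.

## Proof (by contradiction)

If `E₀(HS_R) = ⊤` every trial state is a `δ`-near-minimiser of `HS_R` and `Φ := Ψ` works.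
Otherwise suppose `C` fails: for `T = k + 1` there are `t_k ≥ k + 1` and, for the slack
`δ'_k = 1/(k+1)`, near-minimisers `Ψ_k` of `v_{t_k}` that are `ε`-far from every
`δ`-near-minimiser of `HS_R`. Since `v_t ≤ HS_R` (`v = 0` beyond `R`),
`energy 0 Ψ_k ≤ energy v_{t_k} Ψ_k ≤ E₀(HS_R) + 1 =: B < ⊤`, so `HR` gives `Ψ_{φ i} → Ψ'` in `L²`,
`Ψ'` measurable. The CORE MASS bound `t ∫_{K_R} |Ψ|² ≤ energy v_t Ψ`
(`CutToHardCore.core_mass_le`: on `K_R` one pair term of the interaction is already `≥ t`) and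
`t_{φ i} ≥ i + 1` force `∫_{K_R} |Ψ_{φ i}|² ≤ B/(i+1) → 0`, hence `∫_{K_R} |Ψ'|² = 0` and `Ψ' = 0`
a.e. on `K_R`. By `closedEnergy_le_liminf`,
`closedEnergy 0 L Ψ' ≤ liminf energy 0 Ψ_{φ i} ≤ E₀(HS_R)`, so `HD` gives
`closedEnergy HS_R L Ψ' ≤ E₀(HS_R) < E₀(HS_R) + δ/2`; unfolding the infimum
(`TruncDiagonal.exists_trialState_energy_lt_of_closedEnergy_lt`) yields a hard-sphere trial state
`Φ` with `energy HS_R Φ < E₀ + δ/2` and `∫ |Φ - Ψ'|² ≤ ε/4`; with `∫ |Ψ_{φ i} - Ψ'|² ≤ ε/4` for some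
`i`, the squared triangle inequality gives `∫ |Φ - Ψ_{φ i}|² ≤ ε`, contradicting the choice of
`Ψ_{φ i}`.
-/

noncomputable section

open MeasureTheory Filter Set Metric
open scoped ENNReal NNReal Topology

namespace Summit.AtomisticToContinuum.BoseEinsteinCondensation.Cruxes.HardCoreDominates.Birth

open Literature.MathematicalPhysics.QuantumManyBody.BoseGas
open Literature.Analysis.FunctionSpaces (tendsto_inv_natCast_add_one)
open Summit.AtomisticToContinuum.BoseEinsteinCondensation.Theorems.GroundStateRigidity
  (coe_nnnorm_add_sq_le)
open Summit.AtomisticToContinuum.BoseEinsteinCondensation.Theorems.GroundStateRigidity.TruncDiagonal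
  (exists_trialState_energy_lt_of_closedEnergy_lt)
open Summit.AtomisticToContinuum.BoseEinsteinCondensation.Theorems.GroundStateRigidity.VanishOffFree
  (measurableSet_contactSet)
open Summit.AtomisticToContinuum.BoseEinsteinCondensation.Theorems.GroundStateRigidity.EnergyTrunc
  (groundStateEnergy_mono)

namespace CutToHardCore

variable {N : ℕ} {L : ℝ}

/-- Squared triangle inequality in `L²`: `∫ |f - h|² ≤ 2 ∫ |f - g|² + 2 ∫ |h - g|²` (for measurable
`f`, `g`). [folklore] -/
theorem lintegral_sub_sq_le {f g h : Config N → ℂ} (hf : Measurable f) (hg : Measurable g) :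
    ∫⁻ X, (‖f X - h X‖₊ : ℝ≥0∞) ^ 2 ≤
      2 * (∫⁻ X, (‖f X - g X‖₊ : ℝ≥0∞) ^ 2) + 2 * (∫⁻ X, (‖h X - g X‖₊ : ℝ≥0∞) ^ 2) := by
  have hm : Measurable fun X => 2 * (‖f X - g X‖₊ : ℝ≥0∞) ^ 2 :=
    ((hf.sub hg).nnnorm.coe_nnreal_ennreal.pow_const 2).const_mul 2
  calc ∫⁻ X, (‖f X - h X‖₊ : ℝ≥0∞) ^ 2
      ≤ ∫⁻ X, 2 * (‖f X - g X‖₊ : ℝ≥0∞) ^ 2 + 2 * (‖h X - g X‖₊ : ℝ≥0∞) ^ 2 :=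
        lintegral_mono fun X => by
          have key := coe_nnnorm_add_sq_le (f X - g X) (g X - h X)
          rwa [sub_add_sub_cancel, ← neg_sub (h X) (g X), nnnorm_neg] at key
    _ = 2 * (∫⁻ X, (‖f X - g X‖₊ : ℝ≥0∞) ^ 2) + 2 * (∫⁻ X, (‖h X - g X‖₊ : ℝ≥0∞) ^ 2) := by
        rw [lintegral_add_left hm, lintegral_const_mul' _ _ ENNReal.ofNat_ne_top,
          lintegral_const_mul' _ _ ENNReal.ofNat_ne_top]

/-- The coupling potential `v + t·1_{(-∞,R]}` lies below the hard spheres `⊤·1_{(-∞,R]}` when `v`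
vanishes beyond `R`. [folklore] -/
theorem cut_le_hardSphere {v : ℝ → ℝ≥0∞} {R : ℝ} (hvR : ∀ r : ℝ, R < r → v r = 0) (t : ℝ≥0)
    (r : ℝ) :
    (v + Set.indicator (Set.Iic R) (fun _ : ℝ => (t : ℝ≥0∞))) r ≤
      Set.indicator (Set.Iic R) (fun _ : ℝ => (⊤ : ℝ≥0∞)) r := by
  rw [Pi.add_apply]
  by_cases hr : r ≤ R
  · rw [indicator_of_mem (show r ∈ Set.Iic R from hr) (fun _ : ℝ => (⊤ : ℝ≥0∞))]
    exact le_top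
  · rw [indicator_of_notMem (show r ∉ Set.Iic R from hr),
      indicator_of_notMem (show r ∉ Set.Iic R from hr), add_zero, hvR r (not_le.1 hr)]

/-- The energy of a trial state is monotone in the pair potential. [folklore] -/
theorem energy_mono {v w : ℝ → ℝ≥0∞} (h : ∀ r, v r ≤ w r) (Ψ : TrialState N L) :
    energy v Ψ ≤ energy w Ψ :=
  lintegral_mono fun _ => add_le_add le_rfl
    (mul_le_mul' (Finset.sum_le_sum fun _ _ => Finset.sum_le_sum fun _ _ => h _) le_rfl)

/-- **Core mass bound.** On the core set `K_R = {∃ i ≠ j, |xᵢ - xⱼ| ≤ R}` the coupling interaction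
`∑_{i<j} (v + t·1_{(-∞,R]})(|xᵢ - xⱼ|)` is `≥ t`, hence
`t ∫_{K_R} |Ψ|² ≤ energy (v + t·1_{(-∞,R]}) Ψ`. [folklore] -/
theorem core_mass_le (v : ℝ → ℝ≥0∞) (R : ℝ) (t : ℝ≥0) (Ψ : TrialState N L) :
    (t : ℝ≥0∞) * ∫⁻ X, {Y : Config N | ∃ i j : Fin N, i ≠ j ∧ dist (Y i) (Y j) ≤ R}.indicator
        (fun Y => (‖Ψ.ψ Y‖₊ : ℝ≥0∞) ^ 2) X ≤
      energy (v + Set.indicator (Set.Iic R) (fun _ : ℝ => (t : ℝ≥0∞))) Ψ := by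
  rw [energy, ← lintegral_const_mul' _ _ ENNReal.coe_ne_top]
  refine lintegral_mono fun X => ?_
  by_cases hX : X ∈ {Y : Config N | ∃ i j : Fin N, i ≠ j ∧ dist (Y i) (Y j) ≤ R}
  · rw [indicator_of_mem hX]
    rw [mem_setOf_eq] at hX
    obtain ⟨i, j, hij, hd⟩ := hX
    refine le_add_left (mul_le_mul' ?_ le_rfl)
    calc (t : ℝ≥0∞)
        ≤ (v + Set.indicator (Set.Iic R) (fun _ : ℝ => (t : ℝ≥0∞))) (dist (X i) (X j)) := by
          rw [Pi.add_apply, indicator_of_mem (show dist (X i) (X j) ∈ Set.Iic R from hd)]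
          exact le_add_self
      _ ≤ _ := apply_dist_le_interaction _ X hij
  · rw [indicator_of_notMem hX, mul_zero]
    exact zero_le

/-- A measurable function whose mass on the core set vanishes, `∫ 1_{K_R} |Ψ'|² = 0`, vanishes
a.e. on the core set. [folklore] -/
theorem ae_eq_zero_of_lintegral_indicator_eq_zero {R : ℝ} {Ψ' : Config N → ℂ}
    (hΨ' : Measurable Ψ')
    (h0 : ∫⁻ X, {Y : Config N | ∃ i j : Fin N, i ≠ j ∧ dist (Y i) (Y j) ≤ R}.indicator
        (fun Y => (‖Ψ' Y‖₊ : ℝ≥0∞) ^ 2) X = 0) :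
    ∀ᵐ X : Config N, (∃ i j : Fin N, i ≠ j ∧ dist (X i) (X j) ≤ R) → Ψ' X = 0 := by
  have hKm : Measurable ({Y : Config N | ∃ i j : Fin N, i ≠ j ∧ dist (Y i) (Y j) ≤ R}.indicator
      fun Y => (‖Ψ' Y‖₊ : ℝ≥0∞) ^ 2) :=
    (hΨ'.nnnorm.coe_nnreal_ennreal.pow_const 2).indicator (measurableSet_contactSet N R)
  filter_upwards [(lintegral_eq_zero_iff hKm).1 h0] with X hX hXK
  rw [Pi.zero_apply, indicator_of_mem
    (show X ∈ {Y : Config N | ∃ i j : Fin N, i ≠ j ∧ dist (Y i) (Y j) ≤ R} from hXK)] at hX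
  simpa using hX

end CutToHardCore

open CutToHardCore in
/-- **Stub 2b-G `stub_cutToHardCore_of` of line `birth` — the cut to the hard core.** Given
Rellich compactness for Dirichlet trial states of bounded kinetic energy (`HR`) and the maximal =
minimal form property of the hard spheres (`HD`: a measurable function vanishing a.e. on the core
set has closed hard-sphere energy at most its closed free energy), for every finite-range `v` (`= 0`
beyond `R > 0`), every `(N, L)` and all `δ, ε > 0`: for all large couplings `t` there is a slack
`δ' > 0` such that every `δ'`-near-minimiser of `v + t·1_{(-∞,R]}` is within `ε` in `L²` (squared)
of a `δ`-near-minimiser of the hard spheres `⊤·1_{(-∞,R]}`. Proof by contradiction: bad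
near-minimisers along `t_k → ∞` have bounded kinetic energy, an `L²`-limit `Ψ'` (by `HR`) that
vanishes a.e. on the cores (core mass `≤ energy / t`), `closedEnergy 0 L Ψ' ≤ E₀(HS)` by lower
semicontinuity, so by `HD` hard-sphere trial states of energy `< E₀(HS) + δ` accumulate at `Ψ'` in
`L²` — too close to the bad states. [folklore] -/
theorem stub_cutToHardCore_of :
    (∀ (N : ℕ) (L : ℝ) (B : ENNReal), B ≠ ⊤ →
      ∀ Ψ : ℕ → Literature.MathematicalPhysics.QuantumManyBody.BoseGas.TrialState N L,
        (∀ k : ℕ, Literature.MathematicalPhysics.QuantumManyBody.BoseGas.energy 0 (Ψ k) ≤ B) →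
          ∃ (Ψ' : Literature.MathematicalPhysics.QuantumManyBody.BoseGas.Config N → ℂ) (φ : ℕ → ℕ),
            StrictMono φ ∧ Measurable Ψ' ∧
              Literature.MathematicalPhysics.QuantumManyBody.BoseGas.TendstoL2
                (fun i => Ψ (φ i)) Ψ') →
    (∀ (N : ℕ) (L R : ℝ), 0 < R →
      ∀ Ψ : Literature.MathematicalPhysics.QuantumManyBody.BoseGas.Config N → ℂ, Measurable Ψ →
        (∀ᵐ X : Literature.MathematicalPhysics.QuantumManyBody.BoseGas.Config N,
            (∃ i j : Fin N, i ≠ j ∧ dist (X i) (X j) ≤ R) → Ψ X = 0) →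
          Literature.MathematicalPhysics.QuantumManyBody.BoseGas.closedEnergy
              (Set.indicator (Set.Iic R) (fun _ : ℝ => (⊤ : ENNReal))) L Ψ ≤
            Literature.MathematicalPhysics.QuantumManyBody.BoseGas.closedEnergy 0 L Ψ) →
    ∀ (v : ℝ → ENNReal) (R : ℝ), Measurable v → 0 < R → (∀ r : ℝ, R < r → v r = 0) →
      ∀ (N : ℕ) (L : ℝ) (δ : ENNReal), 0 < δ → ∀ ε : ENNReal, 0 < ε →
        ∃ T : NNReal, ∀ t : NNReal, T ≤ t → ∃ δ' : ENNReal, 0 < δ' ∧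
          ∀ Ψ : Literature.MathematicalPhysics.QuantumManyBody.BoseGas.TrialState N L,
            Literature.MathematicalPhysics.QuantumManyBody.BoseGas.energy
                (v + Set.indicator (Set.Iic R) (fun _ : ℝ => (t : ENNReal))) Ψ ≤
              Literature.MathematicalPhysics.QuantumManyBody.BoseGas.groundStateEnergy
                (v + Set.indicator (Set.Iic R) (fun _ : ℝ => (t : ENNReal))) N L + δ' →
            ∃ Φ : Literature.MathematicalPhysics.QuantumManyBody.BoseGas.TrialState N L,
              Literature.MathematicalPhysics.QuantumManyBody.BoseGas.energy
                  (Set.indicator (Set.Iic R) (fun _ : ℝ => (⊤ : ENNReal))) Φ ≤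
                Literature.MathematicalPhysics.QuantumManyBody.BoseGas.groundStateEnergy
                  (Set.indicator (Set.Iic R) (fun _ : ℝ => (⊤ : ENNReal))) N L + δ ∧
              ∫⁻ X, (‖Φ.ψ X - Ψ.ψ X‖₊ : ENNReal) ^ 2 ≤ ε := by
  intro hR hD v R _hv hRpos hvR N L δ hδ ε hε
  set HS : ℝ → ℝ≥0∞ := Set.indicator (Set.Iic R) (fun _ : ℝ => (⊤ : ℝ≥0∞)) with hHS_def
  set E₀ : ℝ≥0∞ := groundStateEnergy HS N L with hE₀_def
  -- jammed hard spheres: every trial state is a near-minimiser of `HS`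
  rcases eq_or_ne E₀ ⊤ with hEtop | hEtop
  · refine ⟨0, fun t _ => ⟨1, one_pos, fun Ψ _ => ⟨Ψ, ?_, ?_⟩⟩⟩
    · rw [hEtop, top_add]
      exact le_top
    · simp
  -- suppose the conclusion fails: bad near-minimisers along `t_k ≥ k + 1`, slack `1/(k+1)`
  by_contra hcon
  push Not at hcon
  choose t ht hbad using fun k : ℕ => hcon ((k : ℝ≥0) + 1)
  have hδ'pos : ∀ k : ℕ, (0 : ℝ≥0∞) < ((k : ℝ≥0∞) + 1)⁻¹ := fun k =>
    ENNReal.inv_pos.2 (by finiteness)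
  choose Ψ hΨE hΨfar using fun k : ℕ => hbad k (((k : ℝ≥0∞) + 1)⁻¹) (hδ'pos k)
  -- energies are bounded by `B = E₀ + 1 < ⊤`
  have hEB : ∀ k : ℕ, energy (v + Set.indicator (Set.Iic R) (fun _ : ℝ => ((t k : ℝ≥0) : ℝ≥0∞)))
      (Ψ k) ≤ E₀ + ((k : ℝ≥0∞) + 1)⁻¹ := fun k =>
    (hΨE k).trans (add_le_add (groundStateEnergy_mono (cut_le_hardSphere hvR (t k)) N L) le_rfl)
  have hB : ∀ k : ℕ, energy 0 (Ψ k) ≤ E₀ + 1 := fun k =>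
    calc energy 0 (Ψ k)
        ≤ energy (v + Set.indicator (Set.Iic R) (fun _ : ℝ => ((t k : ℝ≥0) : ℝ≥0∞))) (Ψ k) :=
          energy_mono (fun _ => zero_le) _
      _ ≤ E₀ + ((k : ℝ≥0∞) + 1)⁻¹ := hEB k
      _ ≤ E₀ + 1 := add_le_add le_rfl (ENNReal.inv_le_one.2 le_add_self)
  have hBtop : E₀ + 1 ≠ ⊤ := ENNReal.add_ne_top.2 ⟨hEtop, ENNReal.one_ne_top⟩
  -- Rellich: an `L²`-convergent subsequence with measurable limit `Ψ'`
  obtain ⟨Ψ', φ, hφ, hmeas, hL2⟩ := hR N L (E₀ + 1) hBtop Ψ hB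
  -- the core masses along the subsequence tend to zero
  set m : ℕ → ℝ≥0∞ := fun i => ∫⁻ X, {Y : Config N | ∃ i j : Fin N, i ≠ j ∧
    dist (Y i) (Y j) ≤ R}.indicator (fun Y => (‖(Ψ (φ i)).ψ Y‖₊ : ℝ≥0∞) ^ 2) X with hm_def
  have hmle : ∀ i : ℕ, m i ≤ (E₀ + 1) * ((i : ℝ≥0∞) + 1)⁻¹ := by
    intro i
    have hti : (i : ℝ≥0∞) + 1 ≤ (t (φ i) : ℝ≥0∞) :=
      calc (i : ℝ≥0∞) + 1 ≤ (φ i : ℝ≥0∞) + 1 := by gcongr; exact hφ.id_le i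
        _ ≤ (t (φ i) : ℝ≥0∞) := by exact_mod_cast ht (φ i)
    have h1 : m i * ((i : ℝ≥0∞) + 1) ≤ E₀ + 1 :=
      calc m i * ((i : ℝ≥0∞) + 1) ≤ m i * (t (φ i) : ℝ≥0∞) := mul_le_mul' le_rfl hti
        _ = (t (φ i) : ℝ≥0∞) * m i := mul_comm _ _
        _ ≤ energy (v + Set.indicator (Set.Iic R) (fun _ : ℝ => ((t (φ i) : ℝ≥0) : ℝ≥0∞)))
              (Ψ (φ i)) := core_mass_le v R (t (φ i)) (Ψ (φ i))
        _ ≤ E₀ + (((φ i : ℕ) : ℝ≥0∞) + 1)⁻¹ := hEB (φ i)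
        _ ≤ E₀ + 1 := add_le_add le_rfl (ENNReal.inv_le_one.2 le_add_self)
    rw [← div_eq_mul_inv]
    exact (ENNReal.le_div_iff_mul_le (Or.inl (by simp)) (Or.inl (by finiteness))).2 h1
  have hm0 : Tendsto m atTop (𝓝 0) := by
    have h := ENNReal.Tendsto.const_mul tendsto_inv_natCast_add_one (Or.inr hBtop) (a := E₀ + 1)
    rw [mul_zero] at h
    exact tendsto_of_tendsto_of_tendsto_of_le_of_le tendsto_const_nhds h (fun _ => zero_le) hmle
  -- hence the limit vanishes a.e. on the core set
  have hcore : ∀ᵐ X : Config N, (∃ i j : Fin N, i ≠ j ∧ dist (X i) (X j) ≤ R) → Ψ' X = 0 := by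
    refine ae_eq_zero_of_lintegral_indicator_eq_zero hmeas (le_antisymm ?_ zero_le)
    have hg : Tendsto (fun i => 2 * (∫⁻ X, (‖(Ψ (φ i)).ψ X - Ψ' X‖₊ : ℝ≥0∞) ^ 2) + 2 * m i)
        atTop (𝓝 0) := by
      have h1 := ENNReal.Tendsto.const_mul hL2 (Or.inr ENNReal.ofNat_ne_top) (a := 2)
      have h2 := ENNReal.Tendsto.const_mul hm0 (Or.inr ENNReal.ofNat_ne_top) (a := 2)
      have h := h1.add h2
      rw [mul_zero, add_zero] at h
      exact h
    refine le_of_tendsto_of_tendsto' tendsto_const_nhds hg fun i => ?_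
    have hmi : Measurable fun X => 2 * (‖(Ψ (φ i)).ψ X - Ψ' X‖₊ : ℝ≥0∞) ^ 2 :=
      ((((Ψ (φ i)).contDiff.continuous.measurable.sub hmeas).nnnorm.coe_nnreal_ennreal).pow_const
        2).const_mul 2
    calc ∫⁻ X, {Y : Config N | ∃ i j : Fin N, i ≠ j ∧ dist (Y i) (Y j) ≤ R}.indicator
          (fun Y => (‖Ψ' Y‖₊ : ℝ≥0∞) ^ 2) X
        ≤ ∫⁻ X, 2 * (‖(Ψ (φ i)).ψ X - Ψ' X‖₊ : ℝ≥0∞) ^ 2 +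
            2 * {Y : Config N | ∃ i j : Fin N, i ≠ j ∧ dist (Y i) (Y j) ≤ R}.indicator
              (fun Y => (‖(Ψ (φ i)).ψ Y‖₊ : ℝ≥0∞) ^ 2) X := by
          refine lintegral_mono fun X => ?_
          by_cases hX : X ∈ {Y : Config N | ∃ i j : Fin N, i ≠ j ∧ dist (Y i) (Y j) ≤ R}
          · rw [indicator_of_mem hX, indicator_of_mem hX]
            have key := coe_nnnorm_add_sq_le (Ψ' X - (Ψ (φ i)).ψ X) ((Ψ (φ i)).ψ X)
            rwa [sub_add_cancel, ← neg_sub ((Ψ (φ i)).ψ X) (Ψ' X), nnnorm_neg] at key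
          · rw [indicator_of_notMem hX]
            exact zero_le
      _ = 2 * (∫⁻ X, (‖(Ψ (φ i)).ψ X - Ψ' X‖₊ : ℝ≥0∞) ^ 2) + 2 * m i := by
          rw [lintegral_add_left hmi, lintegral_const_mul' _ _ ENNReal.ofNat_ne_top,
            lintegral_const_mul' _ _ ENNReal.ofNat_ne_top]
  -- lower semicontinuity: the closed free energy of the limit is at most `E₀`
  have hcl0 : closedEnergy 0 L Ψ' ≤ E₀ := by
    have h1 : ∀ i : ℕ, energy 0 (Ψ (φ i)) ≤ E₀ + ((i : ℝ≥0∞) + 1)⁻¹ := fun i =>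
      calc energy 0 (Ψ (φ i))
          ≤ energy (v + Set.indicator (Set.Iic R) (fun _ : ℝ => ((t (φ i) : ℝ≥0) : ℝ≥0∞)))
              (Ψ (φ i)) := energy_mono (fun _ => zero_le) _
        _ ≤ E₀ + (((φ i : ℕ) : ℝ≥0∞) + 1)⁻¹ := hEB (φ i)
        _ ≤ E₀ + ((i : ℝ≥0∞) + 1)⁻¹ := by gcongr; exact hφ.id_le i
    have h2 : Tendsto (fun i : ℕ => E₀ + ((i : ℝ≥0∞) + 1)⁻¹) atTop (𝓝 (E₀ + 0)) :=
      tendsto_const_nhds.add tendsto_inv_natCast_add_one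
    rw [add_zero] at h2
    calc closedEnergy 0 L Ψ'
        ≤ liminf (fun i => energy 0 (Ψ (φ i))) atTop := closedEnergy_le_liminf 0 hL2
      _ ≤ liminf (fun i : ℕ => E₀ + ((i : ℝ≥0∞) + 1)⁻¹) atTop :=
          liminf_le_liminf (Eventually.of_forall h1)
      _ = E₀ := h2.liminf_eq
  -- `HD` and the infimum defining the closed hard-sphere energy: a good hard-sphere state near `Ψ'`
  set η : ℝ≥0∞ := ε / 2 / 2 with hη_def
  have hη0 : 0 < η := ENNReal.half_pos (ENNReal.half_pos hε.ne').ne'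
  have hδ2 : δ / 2 ≠ 0 := (ENNReal.half_pos hδ.ne').ne'
  have hlt : closedEnergy HS L Ψ' < E₀ + δ / 2 :=
    ((hD N L R hRpos Ψ' hmeas hcore).trans hcl0).trans_lt (ENNReal.lt_add_right hEtop hδ2)
  obtain ⟨Φ, hΦE, hΦd⟩ := exists_trialState_energy_lt_of_closedEnergy_lt hlt hη0
  have hΦE' : energy HS Φ ≤ E₀ + δ := hΦE.le.trans (add_le_add le_rfl ENNReal.half_le_self)
  -- a member of the subsequence near `Ψ'`, hence near `Φ`: contradiction
  obtain ⟨i, hi⟩ := (Tendsto.eventually_le_const hη0 hL2).exists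
  have hle : ∫⁻ X, (‖Φ.ψ X - (Ψ (φ i)).ψ X‖₊ : ℝ≥0∞) ^ 2 ≤ ε :=
    calc ∫⁻ X, (‖Φ.ψ X - (Ψ (φ i)).ψ X‖₊ : ℝ≥0∞) ^ 2
        ≤ 2 * (∫⁻ X, (‖Φ.ψ X - Ψ' X‖₊ : ℝ≥0∞) ^ 2) +
            2 * (∫⁻ X, (‖(Ψ (φ i)).ψ X - Ψ' X‖₊ : ℝ≥0∞) ^ 2) :=
          lintegral_sub_sq_le Φ.contDiff.continuous.measurable hmeas
      _ ≤ 2 * η + 2 * η := add_le_add (mul_le_mul' le_rfl hΦd) (mul_le_mul' le_rfl hi)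
      _ = ε := by rw [← mul_add, ENNReal.add_halves, two_mul, ENNReal.add_halves]
  exact absurd hle (not_le.2 (hΨfar (φ i) Φ hΦE'))

end Summit.AtomisticToContinuum.BoseEinsteinCondensation.Cruxes.HardCoreDominates.Birth

end
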